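import Summits.ResolutionOfSingularities.ResolutionOfSingularities.Theses.JacobianBudget
import Summits.ResolutionOfSingularities.ResolutionOfSingularities.Theorems.JacobianBudgetIsolatedJacobianDropCharTwo

/-!
# Crux `IsolatedJacobianDrop` (stmt-ResolutionOfSingularities-18946, route `JacobianBudget`) —
# the crux BY NAME reduced to odd characteristic

Leaf over `Theorems/JacobianBudgetIsolatedJacobianDropCharTwo.lean` (the whole characteristic-two
case of the budget, `JacobianBudget.CharTwo.singleStepDrop_of_eq_two`): the crux
`Theses.JacobianBudget.IsolatedJacobianDrop` follows from its one-step form at ODD primes alone —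
`isolatedJacobianDrop_of_odd`. The hypothesis is the binder shape of `JacobianBudget.SingleStepDrop`
(`Theorems/JacobianBudgetDefs.lean`) with `p ≠ 2` added, stated over the named calculus
`step/Isol/MultP/mu` of `Theorems/WildConesClassicalRegimesDefs.lean` with the decrement
`((p - 1) ^ n * (p + 1) + 1 - 2 * ((n + 1) % 2)) / p` written out (verbatim the crux's `let Δ` and
the body of `JacobianBudget.Δ`); the proof is the definitional unfolding of the crux's fourteen
`let`s (they ARE the `WildCones` definitions; `run (m+1) = step (i m) (t m) (run m)`) and a case
split on `p = 2`.

This file imports the route thesis file directly because it concludes the crux BY NAME (chain W4.1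
import discipline: leaves only); it does not import `JacobianBudgetDefs`. BANK item of chain W4.1
(campaign res-hironaka, rung L, slot W4.1), explicitly not summit progress. Everything here is OURS;
it replaces the role of no printed item and is NOT a statement of Hironaka's manuscript. [folklore]
-/

noncomputable section

-- single-problem summit: the doubled namespace component `ResolutionOfSingularities` is forced
set_option linter.dupNamespace false

open scoped BigOperators Classical

open Summit.ResolutionOfSingularities.ResolutionOfSingularities.Theses.JacobianBudget (IsolatedJacobianDrop)
open Summit.ResolutionOfSingularities.ResolutionOfSingularities.Theorems.WildCones
  (step run Isol MultP mu)

namespace Summit.ResolutionOfSingularities.ResolutionOfSingularities.Theorems.JacobianBudget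

/-- **THE CRUX `IsolatedJacobianDrop` BY NAME, REDUCED TO ODD PRIMES.** If at every ODD prime `p`
the one-step budget holds — whenever a state `c` and its successor `step i τ c` over a perfect field
of characteristic `p` are both isolated of multiplicity `p`, `μ(step i τ c) + Δ_n(p) ≤ μ(c)` — then
`Theses.JacobianBudget.IsolatedJacobianDrop` holds: the prime `2` is
`CharTwo.singleStepDrop_of_eq_two`, and the crux's `let`s unfold definitionally onto the named
calculus at `(run m, i m, t m)`. OURS; NOT a statement of Hironaka's manuscript. [folklore] -/
theorem isolatedJacobianDrop_of_odd
    (hodd : ∀ p : ℕ, p.Prime → p ≠ 2 → ∀ n : ℕ, 0 < n → ∀ (κ : Type) [Field κ] [CharP κ p]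
      [PerfectField κ] (c : (Fin n → ℕ) → κ) (i : Fin n) (τ : Fin n → κ),
      Isol p n κ c → MultP p n κ c → Isol p n κ (step p n κ i τ c) → MultP p n κ (step p n κ i τ c) →
        mu p n κ (step p n κ i τ c) + ((p - 1) ^ n * (p + 1) + 1 - 2 * ((n + 1) % 2)) / p ≤
          mu p n κ c) :
    IsolatedJacobianDrop := by
  intro p hp n hn κ _ _ _ c₀ i t _ _ _ _ _ _ _ _ _ _ _ _ _ _ m k1 k2 k3 k4
  by_cases h2 : p = 2
  · exact CharTwo.singleStepDrop_of_eq_two p h2 n κ (run p n κ c₀ i t m) (i m) (t m) k1 k2 k3 k4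
  · exact hodd p hp h2 n hn κ (run p n κ c₀ i t m) (i m) (t m) k1 k2 k3 k4

end Summit.ResolutionOfSingularities.ResolutionOfSingularities.Theorems.JacobianBudget

end
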